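import Summits.AtomisticToContinuum.HydrodynamicLimit.Theses.AthermalClockWard

/-!
# Birth skeleton (BC3) for crux `ResponseToMeans` — stmt-AtomisticToContinuum-17926
(route `AthermalClockWard`, rank 5, sub-problem `AtomisticToContinuum/HydrodynamicLimit`)

Crux (FIXED, concluded BY NAME):
`Summit.AtomisticToContinuum.HydrodynamicLimit.Theses.AthermalClockWard.ResponseToMeans :=
   MomentumFluxResponse → EnergyFluxResponse → MeanHydroLimitInBand` —
"RESPONSE ⇒ MEANS": if the one athermal covariance `Cov_{LG_N}(K_N, U_N(Φ_{N,s} z))` converges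
uniformly on `[0,t]` to `(s∂_s + D′)U^E` in the dilute band (its momentum clause = `MomentumFluxResponse`,
its energy clause = `EnergyFluxResponse`), then the EXPECTATIONS of the three empirical fields under the
local Gibbs law converge to the Euler fields at every `t < T` in the same band.

## The cut (the route's own two-layer plan for this node: Spohn1991 §3.2 (3.14)–(3.17), §7.1 (7.16);
DuftyBaskaranBrey2008 §7; LebowitzPercusVerlet1967; Glynn1990)

The crux is the composite of the route's four provable-now finite-`N` / measure-theoretic SUPPORT items,
none of which is proved in the tree yet (grounder note 2026-08-17); each is a registered stub here, stated
BY NAME (the support decls of the route file are the stub signatures, so closing a stub closes an item):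

* `stub_localGibbsStatics` (M) — `LocalGibbsStatics`: for `0 < σ < 1/2` the local Gibbs law is a
  probability measure, the kinetic energy per particle has mean `≤ C` uniformly in `N, Φ`, and — the
  velocities being independent Gaussians `N(u₀(x_i), θ₀(x_i) I)` given the positions — the momentum and
  energy fields have means `E⟨n_N, χ u₀,j⟩`, `E⟨n_N, χ(|u₀|²/2 + 3θ₀/2)⟩` (so the `t = 0` density LLN
  gives the `t = 0` means of all three fields). Gaussian statics (`lintegral_localGibbsMeasure`,
  `isProbabilityMeasure_localGibbsLaw`).
* `stub_meanMassContinuity` (M/L) — `MeanMassContinuity`: the exact MEAN continuity equation at finite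
  `N` (no collision term in the mass flux): `s ↦ E⟨n_N(Φ_s z), χ⟩` has derivative
  `h(t) = E Σ_j ⟨m_N(Φ_t z), ∂_jχ⟩_j` within `[0,∞)` and `h` is continuous there (pathwise FTC along
  piecewise-free trajectories, energy-dominated; a collision at a FIXED time has probability `0`).
* `stub_wardIdentity` (L, HARDEST) — `WardIdentity`: the finite-`N` athermal WARD IDENTITIES
  `t∂_tV + D′V = Cov(·, K)`, `D′ = diag(0,1,2)`, `K = Σ_i[(|v_i|² − v_i·u₀(x_i))/θ₀(x_i) − 3]` the
  initial energy score: `d/dc` at `c = 1` of the exponential family `localGibbsLaw σ a₀ (c u₀) (c² θ₀)`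
  transported by the flow (ScalingCovariance = `IsHardSphereTrajectory.timeDilate` + Gaussian change of
  variables), differentiated UNDER the integral (Gaussian tails × energy-bounded fields, flow
  measurability) — the one place the typed risk of the crux ("fails only AS TYPED") lives.
* `stub_wardToMeans` (L) — `WardToMeans`: the analytic glue
  `OneDirectionResponse → WardIdentity → MeanMassContinuity → LocalGibbsStatics → MeanHydroLimitInBand`:
  one FTC on `(0,t]` for `s V_j(s)`, `s² V_e(s)` with the `s ↓ 0` boundary term killed by the energy
  bound, the `t = 0` means from the statics, the density means from the mass equation and
  `Torus.integral_divergence_eq_zero`; thresholds `η := η_R`, `σ₀ := min(σ_R, 1/2)`.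

Composition `ResponseToMeans_of` (PROVED, no `sorry`; not a one-line seam): the two flux closures are
merged at the common thresholds `η := min η_Rm η_Re`, `σ₀ := min σ_Rm σ_Re` into `OneDirectionResponse`
(`oneDirectionResponse_of_flux`, the `odr` of the route text), then
`ResponseToMeans = fun hRm hRe => WardToMeans (odr hRm hRe) WardIdentity MeanMassContinuity LocalGibbsStatics`.

Disproof used: none — the crux has no `Disproof.lean` / `Negative/` lemmas (`ledger crux ls
stmt-AtomisticToContinuum-17926`: no workfiles, 2026-08-17); the negatives index (20 entries, 2026-08-17)
has nothing on items 11927–11936 / 17509–17510 / 17926–17927. Barriers honoured: the stubs are exact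
finite-`N` identities and measure-theoretic glue — BoltzmannHypothesisBarrier / HighMomentumCutoffBarrier
bite only on the flux-closure cruxes `MomentumFluxResponse`, `EnergyFluxResponse`, which stay HYPOTHESES of
the crux (never derived here); `K` has Gaussian moments under the local Gibbs law.
-/

namespace Summit.AtomisticToContinuum.HydrodynamicLimit.Cruxes.ResponseToMeans.Birth

open Summit.AtomisticToContinuum.HydrodynamicLimit.Theses.AthermalClockWard (MomentumFluxResponse
  EnergyFluxResponse MeanHydroLimitInBand OneDirectionResponse WardIdentity MeanMassContinuity
  LocalGibbsStatics WardToMeans ResponseToMeans)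

/-! ### Glue (proved): the two flux closures at a common threshold are the one-direction response -/

/-- `odr` of the route text: `MomentumFluxResponse → EnergyFluxResponse → OneDirectionResponse`, taking
`η := min η_Rm η_Re` and, given the profiles, `σ₀ := min σ_Rm σ_Re`; the packing guard `< min` feeds both. -/
theorem oneDirectionResponse_of_flux (hRm : MomentumFluxResponse) (hRe : EnergyFluxResponse) :
    OneDirectionResponse := by
  obtain ⟨η₁, hη₁, H₁⟩ := hRm
  obtain ⟨η₂, hη₂, H₂⟩ := hRe
  refine ⟨min η₁ η₂, lt_min hη₁ hη₂, ?_⟩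
  intro a₀ θ₀ u₀ ha hθ hu ha0 hθ0
  obtain ⟨σ₁, hσ₁, G₁⟩ := H₁ a₀ θ₀ u₀ ha hθ hu ha0 hθ0
  obtain ⟨σ₂, hσ₂, G₂⟩ := H₂ a₀ θ₀ u₀ ha hθ hu ha0 hθ0
  refine ⟨min σ₁ σ₂, lt_min hσ₁ hσ₂, ?_⟩
  intro σ hσ hσ' T ρ θ u hE hpack Φ h0 t ht χ hχ
  have h1 : σ < σ₁ := lt_of_lt_of_le hσ' (min_le_left _ _)
  have h2 : σ < σ₂ := lt_of_lt_of_le hσ' (min_le_right _ _)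
  have hp1 : ∀ s ∈ Set.Ico 0 T, ∀ x, ρ s x * σ ^ 3 < η₁ :=
    fun s hs x => lt_of_lt_of_le (hpack s hs x) (min_le_left _ _)
  have hp2 : ∀ s ∈ Set.Ico 0 T, ∀ x, ρ s x * σ ^ 3 < η₂ :=
    fun s hs x => lt_of_lt_of_le (hpack s hs x) (min_le_right _ _)
  exact ⟨fun j => G₁ σ hσ h1 T ρ θ u hE hp1 Φ h0 t ht χ hχ j, G₂ σ hσ h2 T ρ θ u hE hp2 Φ h0 t ht χ hχ⟩

/-! ### Registered stubs (the open obligations of the line; `sorry` only here) -/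

/-- STUB S1 (M; Gaussian statics of the local Gibbs law — route support item `LocalGibbsStatics`,
stmt-AtomisticToContinuum-11933). -/
theorem stub_localGibbsStatics : LocalGibbsStatics := by
  sorry

/-- STUB S2 (M/L; exact mean continuity equation at finite `N` — route support item `MeanMassContinuity`,
stmt-AtomisticToContinuum-11932). -/
theorem stub_meanMassContinuity : MeanMassContinuity := by
  sorry

/-- STUB S3 (L; HARDEST — the finite-`N` athermal Ward identities, differentiation of the transported
exponential family under the integral — route support item `WardIdentity`, stmt-AtomisticToContinuum-11931). -/
theorem stub_wardIdentity : WardIdentity := by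
  sorry

/-- STUB S4 (L; the analytic glue: FTC on `(0,t]` + boundary term + density step — route support item
`WardToMeans`, stmt-AtomisticToContinuum-11935). -/
theorem stub_wardToMeans : WardToMeans := by
  sorry

/-! ### Composition (PROVED): the four stubs give the crux BY NAME -/

/-- **The line concludes the crux BY NAME.**
`LocalGibbsStatics → MeanMassContinuity → WardIdentity → WardToMeans → ResponseToMeans` (no `sorry`):
merge the two flux closures into `OneDirectionResponse` at the common thresholds
(`oneDirectionResponse_of_flux`) and feed it, with the three finite-`N` identities, to the analytic glue. -/
theorem ResponseToMeans_of (hS : LocalGibbsStatics) (hC : MeanMassContinuity) (hW : WardIdentity)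
    (hG : WardToMeans) : ResponseToMeans := by
  intro hRm hRe
  exact hG (oneDirectionResponse_of_flux hRm hRe) hW hC hS

/-- Wiring check: the registered stubs feed `ResponseToMeans_of` as stated. -/
example : ResponseToMeans :=
  ResponseToMeans_of stub_localGibbsStatics stub_meanMassContinuity stub_wardIdentity stub_wardToMeans

end Summit.AtomisticToContinuum.HydrodynamicLimit.Cruxes.ResponseToMeans.Birth
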